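import Literature.AnabelianGeometry.SemiGraphs.TemperedMaximalCompactAt
import Literature.AnabelianGeometry.SemiGraphs.TemperedThm37OfNoCore
import Literature.AnabelianGeometry.SemiGraphs.TemperedConj2OfLocallyFinite
import Literature.AnabelianGeometry.SemiGraphs.TemperedVerticialDistinctSameVertex
import Literature.AnabelianGeometry.SemiGraphs.TemperedEdgeLikeIsInfVerticialHolds
import HarnessLib

/-!
# [SemiAnbd] Thm 3.7 (iv) AT every countable graph without core / locally finite graph, MODULO the
# existence sentence of Thm 3.7 (iii) — «maximal compact ⇔ verticial; intersections = edge-like»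

Mochizuki, *Semi-graphs of anabelioids*, Publ. RIMS **42** (2006), §3, Theorem 3.7 (iii)–(iv), manuscript
pp. 40–41 ("the maximal compact subgroups of `π₁^temp(𝒢)` are precisely the verticial subgroups"; "the
nontrivial intersections of two distinct maximal compact subgroups … are precisely the edge-like subgroups")
[cite: MochizukiSemiAnbd2006, Thm 3.7(iv) p.41].

PROOF-ONLY (abc-iut cell, layer L3; seat abc-iut-w4-d064 gen 7; sequel (s2) to row «DECOMP-CT@NO-CORE-ℍ»;
drafted by abc-iut-w4-d064 g7, filed by abc-iut-w5-d160 g11 — verbatim adoption under L3-lead ruling γ59 (2),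
row «T37iv@NO-CORE adopt-file»).
abc-iut-w4-d075's per-graph bridge `maximalCompactIffVerticialAt_of` derives Thm 3.7 (iv) AT `𝒢`
(`MaximalCompactIffVerticialAt 𝒢`) from Thm 3.7 (iii) AT `𝒢` (`CompactInVerticialAt 𝒢`) and the two
rung-4 inputs, BOTH now theorems (`verticialDistinct_holds`, abc-iut-L3-t11 lineage;
`edgeLikeIsInfVerticialAt_holds`, abc-iut-f-173).  At a countable graph WITHOUT an infinitely-branching
core (abc-iut-f-176, `compactInVerticialAt_iff_exists_verticial_of_noCore`) resp. a LOCALLY FINITE graph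
(abc-iut-w6-d062, `compactInVerticialAt_iff_exists_verticial_of_isLocallyFinite`) Thm 3.7 (iii) AT `𝒢` is
equivalent to its EXISTENCE SENTENCE («every compact subgroup lies in SOME verticial subgroup»).  Hence:

* `maximalCompactIffVerticialAt_of_exists_verticial_of_noCore (hNC) (hex)` and
  `…_of_isLocallyFinite (hlf) (hex)`, `…_of_rank (ρ) (hρ) (hex)` — Thm 3.7 (iv) AT such `𝒢` with the
  ∃-sentence `hex` as the ONLY binder beyond the class hypothesis (honest: `hex` is NOT asserted; as a
  bare ∀-closure over countable graphs it fails, e.g. at the countermodel `𝒢_θ` of record; it is a theorem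
  for finite graphs and for the universal graph-coverings `𝒢_{∞,F}`).

Theorems only; no `def`, no instance, no new `Prop` fact; a class-level closer modulo a displayed
hypothesis ≠ the node proved in print; nothing here bears on [IUTchIII] Cor. 3.12.
-/

namespace Literature.AnabelianGeometry.SemiGraphs

namespace ProfiniteSemiGraph

open CategoryTheory Topology

universe u

variable (𝒢 : ProfiniteSemiGraph.{u})

/-- **Thm 3.7 (iv) AT a countable graph without core, modulo the ∃-sentence of (iii)**: maximal compact
⇔ verticial, and nontrivial intersections of two distinct maximal compact subgroups = edge-like subgroups
of closed edges — for every chart — from the no-core clause `hNC` and «every compact subgroup lies in some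
verticial subgroup» (`hex`). [cite: MochizukiSemiAnbd2006, Thm 3.7(iv) p.41] -/
theorem maximalCompactIffVerticialAt_of_exists_verticial_of_noCore
    (hNC : ∀ S : Set 𝒢.graph.Vertex, S.Nonempty → ∃ w ∈ S,
      {b : 𝒢.graph.Branch | 𝒢.graph.abuts b = some w ∧ ∃ b', b' ≠ b ∧ 𝒢.graph.edgeOf b' = 𝒢.graph.edgeOf b ∧
        ∃ w' ∈ S, 𝒢.graph.abuts b' = some w'}.Finite)
    (hex : 𝒢.Thm37Hypotheses → ∀ (c : TemperedPiChart 𝒢) (C : Subgroup c.G), IsCompact (C : Set c.G) →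
      ∃ (v : 𝒢.graph.Vertex) (H : Subgroup c.G), H ∈ verticialSubgroups c v ∧ C ≤ H) :
    MaximalCompactIffVerticialAt 𝒢 :=
  maximalCompactIffVerticialAt_of ((𝒢.compactInVerticialAt_iff_exists_verticial_of_noCore hNC).mpr hex)
    verticialDistinct_holds (edgeLikeIsInfVerticialAt_holds 𝒢)

/-- **Thm 3.7 (iv) AT a ranked graph, modulo the ∃-sentence of (iii)** (no-core clause from a rank function,
abc-iut-f-176's `SemiGraph.noCore_of_rank`). [cite: MochizukiSemiAnbd2006, Thm 3.7(iv) p.41] -/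
theorem maximalCompactIffVerticialAt_of_exists_verticial_of_rank (ρ : 𝒢.graph.Vertex → ℕ)
    (hρ : ∀ w : 𝒢.graph.Vertex, {b : 𝒢.graph.Branch | 𝒢.graph.abuts b = some w ∧
      ∃ b', b' ≠ b ∧ 𝒢.graph.edgeOf b' = 𝒢.graph.edgeOf b ∧
        ∃ w', 𝒢.graph.abuts b' = some w' ∧ ρ w ≤ ρ w'}.Finite)
    (hex : 𝒢.Thm37Hypotheses → ∀ (c : TemperedPiChart 𝒢) (C : Subgroup c.G), IsCompact (C : Set c.G) →
      ∃ (v : 𝒢.graph.Vertex) (H : Subgroup c.G), H ∈ verticialSubgroups c v ∧ C ≤ H) :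
    MaximalCompactIffVerticialAt 𝒢 :=
  𝒢.maximalCompactIffVerticialAt_of_exists_verticial_of_noCore (SemiGraph.noCore_of_rank 𝒢.graph ρ hρ) hex

/-- **Thm 3.7 (iv) AT a locally finite graph, modulo the ∃-sentence of (iii)** (abc-iut-w6-d062's
`compactInVerticialAt_iff_exists_verticial_of_isLocallyFinite`). [cite: MochizukiSemiAnbd2006, Thm 3.7(iv) p.41] -/
theorem maximalCompactIffVerticialAt_of_exists_verticial_of_isLocallyFinite (hlf : 𝒢.graph.IsLocallyFinite)
    (hex : 𝒢.Thm37Hypotheses → ∀ (c : TemperedPiChart 𝒢) (C : Subgroup c.G), IsCompact (C : Set c.G) →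
      ∃ (v : 𝒢.graph.Vertex) (H : Subgroup c.G), H ∈ verticialSubgroups c v ∧ C ≤ H) :
    MaximalCompactIffVerticialAt 𝒢 :=
  maximalCompactIffVerticialAt_of ((𝒢.compactInVerticialAt_iff_exists_verticial_of_isLocallyFinite hlf).mpr hex)
    verticialDistinct_holds (edgeLikeIsInfVerticialAt_holds 𝒢)

end ProfiniteSemiGraph

end Literature.AnabelianGeometry.SemiGraphs
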